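import Literature.MathematicalPhysics.QuantumFieldTheory.Balaban1983to89.B4TorusKernel

/-!
# `Balaban1983to89.Beta.AliasingTail` — the ALIASING (RIEMANN-SUM) TAIL BOUND for strip-regular multipliers

For a lattice kernel with `‖K(y)‖ ≤ M e^{-κ|y|_∞}` (`κ > 0`) and a period `N ≥ 1`, the periodised value at the origin differs
from `K(0)` by the off-centre translates only:
`‖Σ_{m ∈ ℤ^{d+1}} K(Nm) − K(0)‖ ≤ M · e^{−κN} · ((3 − ρ)/(1 − ρ))^{d+1}`, `ρ = e^{−κN/(d+1)}` (`norm_tsum_translate_sub_le`),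
and hence, by the torus dictionary of `B4TorusKernel` (§6, `torusKernel_descend_eq`: torus kernel of a strip-regular multiplier =
periodised lattice kernel) and the Paley–Wiener bound `B4ContourShift.latticeKernel_decay`, the NORMALISED GRID SUM of a
strip-regular multiplier `G` over the dual grid `(2π/N)ℤ_N^{d+1}` differs from its Brillouin-zone mean `latticeKernel G 0 =
(2π)^{-(d+1)} ∫_{[-π,π]^{d+1}} G` by at most `M · aliasConst κ N d` (`norm_torusKernel_zero_sub_latticeKernel_zero_le`), with
`aliasConst κ N d = e^{−κN}((3 − ρ)/(1 − ρ))^{d+1} → 0` geometrically in `N` (for `N` large it is `≈ 3^{d+1} e^{−κN}`: the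
`3^{d+1} − 1` nearest translates).  This is the analytic input that turns a certified value of a FINITE grid sum (a torus
computation at fixed period) into a certified enclosure of the infinite-volume Brillouin-zone integral, once `(κ, M)` are known.

CITATION HEADER (lean-in-tree rule 2026-08-18).  Source: T. Bałaban, *Propagators and renormalization transformations for
lattice gauge theories. I*, Commun. Math. Phys. **95**, 17–40 (1984) [Balaban1984PropagatorsI] (cell paper B5; held
`paper:balaban1984-cmp95-propagators-rt-i`, PDF page = journal page − 16).  Locators (dictionary only, quoted verbatim in the
header of `B4TorusKernel`): p. 36 l. 20–23 «Probably the simplest proof of the exponential decay properties can be obtained by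
relating G on the torus to G on the whole lattice ηZ^d in the usual way» (= periodisation, `B4TorusKernel.torusKernel_descend_eq`)
and p. 38 (1.126) (exponential decay of kernels, `B4ContourShift.latticeKernel_decay` for the generic strip-regular multiplier).
No formula of the source is newly quoted or used here; the content of this module is the [folklore] estimate of the Poisson
summation remainder (product majorant of `e^{−κN|m|_∞}` over `m ≠ 0` and the two-sided geometric series).

HONEST FRAMING (cell rule, verbatim, page 1 of everything): discharging BetaPertH makes Bałaban's UV stability
UNCONDITIONAL — a real constructive-QFT result; it is NOT the continuum limit and NOT the Clay problem.
ABSOLUTE RULE (cell rule, verbatim): "No internally-minted statement may enter as a cited fact. Every hypothesis is either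
kernel-proved in this package or a verbatim quotation of a PUBLISHED theorem with page reference."  Everything below is
kernel-proved; nothing is asserted about any coefficient of Bałaban's: the module bounds an abstract periodisation remainder.
USE (cell file BETA/CAP-KERNEL.md §4.4/§4.8, computer-assisted one-loop lane): with `G` the Bloch-momentum integrand of a
one-loop coefficient, holomorphic and bounded by `M` on the polystrip `|Im q_μ| ≤ κ` (`StripRegular G κ M`, to be CERTIFIED
outside the kernel), the engines' grid value `T_N = N^{-(d+1)} Σ_k G(2πk/N)` and the coefficient `c = latticeKernel G 0` satisfy
`‖T_N − c‖ ≤ M · aliasConst κ N d`; the kernel then only compares explicit reals (`Certified.SmallKCert.lo_le` stays the leaf).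
Value = kernel-checked folklore estimate (export interface of the CAP lane), NOT summit progress (audit cell `pub-balaban`,
β sub-cell, lane cap3 = kernel algebra + export, unit `b2b-balaban-beta-cap3`).
-/

namespace Literature.MathematicalPhysics.QuantumFieldTheory.Balaban1983to89.Beta.AliasingTail

open Literature.MathematicalPhysics.QuantumFieldTheory.Balaban1983to89.B4ContourShift
open Literature.MathematicalPhysics.QuantumFieldTheory.Balaban1983to89.B4TorusKernel
open Finset
open scoped Real

noncomputable section

variable {d : ℕ}

/-! ### §1. The constants -/

/-- the ratio `ρ = e^{-κN/(d+1)}` of the product majorant. [folklore] -/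
def aliasRatio (κ : ℝ) (N d : ℕ) : ℝ := Real.exp (-(κ * N / (d + 1)))

/-- the ALIASING CONSTANT `A(κ, N, d) = e^{-κN} · ((3 - ρ)/(1 - ρ))^{d+1}`, `ρ = e^{-κN/(d+1)}`: an upper bound for
`Σ_{m ∈ ℤ^{d+1}, m ≠ 0} e^{-κN|m|_∞}`. [folklore] -/
def aliasConst (κ : ℝ) (N d : ℕ) : ℝ :=
  Real.exp (-(κ * N)) * ((3 - aliasRatio κ N d) / (1 - aliasRatio κ N d)) ^ (d + 1)

/-- `ρ > 0`. [folklore] -/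
theorem aliasRatio_pos (κ : ℝ) (N d : ℕ) : 0 < aliasRatio κ N d := Real.exp_pos _

/-- `ρ < 1` for `κ > 0`, `N ≥ 1`. [folklore] -/
theorem aliasRatio_lt_one {κ : ℝ} (hκ : 0 < κ) {N : ℕ} (hN : 1 ≤ N) (d : ℕ) : aliasRatio κ N d < 1 := by
  unfold aliasRatio
  rw [Real.exp_lt_one_iff]
  have hN' : (0 : ℝ) < N := by exact_mod_cast hN
  have : 0 < κ * N / (d + 1) := by positivity
  linarith

/-- `A(κ, N, d) ≥ 0` for `κ > 0`, `N ≥ 1`. [folklore] -/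
theorem aliasConst_nonneg {κ : ℝ} (hκ : 0 < κ) {N : ℕ} (hN : 1 ≤ N) (d : ℕ) : 0 ≤ aliasConst κ N d := by
  unfold aliasConst
  have h1 := aliasRatio_lt_one hκ hN d
  have h0 := aliasRatio_pos κ N d
  apply mul_nonneg (Real.exp_pos _).le
  apply pow_nonneg
  apply div_nonneg <;> linarith

/-! ### §2. One dimension: `Σ_{j ∈ ℤ} ρ^{(|j| - 1)₊} = (3 - ρ)/(1 - ρ)` -/

/-- the one-dimensional weight `ρ^{(|j|-1)₊}` (truncated subtraction: weight `1` at `j = 0, ±1`). [folklore] -/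
def weight (ρ : ℝ) (j : ℤ) : ℝ := ρ ^ (j.natAbs - 1)

/-- the weight is nonnegative for `ρ ≥ 0`. [folklore] -/
theorem weight_nonneg {ρ : ℝ} (h0 : 0 ≤ ρ) (j : ℤ) : 0 ≤ weight ρ j := pow_nonneg h0 _

/-- `Σ_{j ∈ ℤ} ρ^{(|j|-1)₊} = 1 + 2/(1-ρ) = (3-ρ)/(1-ρ)` for `0 ≤ ρ < 1`. [folklore] -/
theorem hasSum_weight {ρ : ℝ} (h0 : 0 ≤ ρ) (h1 : ρ < 1) :
    Summable (weight ρ) ∧ ∑' j : ℤ, weight ρ j = (3 - ρ) / (1 - ρ) := by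
  have hg := summable_geometric_of_lt_one h0 h1
  have hgs : ∑' n : ℕ, ρ ^ n = (1 - ρ)⁻¹ := tsum_geometric_of_lt_one h0 h1
  -- nonnegative integers: weight ρ n = ρ^(n-1)
  have hnat : (fun n : ℕ => weight ρ (n : ℤ)) = fun n => ρ ^ (n - 1) := by
    funext n; simp [weight]
  -- negative integers: weight ρ (-(n+1)) = ρ^n
  have hneg : (fun n : ℕ => weight ρ (-(n + 1 : ℤ))) = fun n => ρ ^ n := by
    funext n
    simp only [weight, Int.natAbs_neg]
    have : (n + 1 : ℤ).natAbs = n + 1 := by omega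
    rw [this]; simp
  have hshift : Summable (fun n : ℕ => ρ ^ (n - 1)) ∧ ∑' n : ℕ, ρ ^ (n - 1) = 1 + (1 - ρ)⁻¹ := by
    have e : ∀ n : ℕ, ρ ^ (n + 1 - 1) = ρ ^ n := fun n => by simp
    have hs1 : Summable (fun n : ℕ => ρ ^ (n + 1 - 1)) := by simp_rw [e]; exact hg
    have hs : Summable (fun n : ℕ => ρ ^ (n - 1)) := (summable_nat_add_iff 1).mp hs1
    refine ⟨hs, ?_⟩
    rw [hs.tsum_eq_zero_add]
    simp_rw [e]
    rw [hgs]; simp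
  have h1' : Summable fun n : ℕ => weight ρ (n : ℤ) := by rw [hnat]; exact hshift.1
  have h3 : Summable fun n : ℕ => weight ρ (-(n + 1 : ℤ)) := by rw [hneg]; exact hg
  refine ⟨Summable.of_nat_of_neg_add_one h1' h3, ?_⟩
  rw [tsum_of_nat_of_neg_add_one h1' h3, hnat, hneg, hshift.2, hgs]
  have hpos : (1 - ρ) ≠ 0 := by linarith
  field_simp
  ring

/-! ### §3. The product majorant of `e^{-κ N |m|_∞}` over `m ≠ 0` -/

/-- coordinates of the translate `N m` of the origin. [folklore] -/
theorem translate_zero_apply (N : ℕ) (m : Fin (d + 1) → ℤ) (i : Fin (d + 1)) :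
    translate N 0 m i = N * m i := by
  rw [translate_apply]; simp

/-- `N · 0 = 0`. [folklore] -/
@[simp] theorem translate_zero_zero (N : ℕ) : translate N (0 : Fin (d + 1) → ℤ) 0 = 0 := by
  funext i; rw [translate_apply]; simp

/-- for `m ≠ 0`: `κ |Nm|_∞ ≥ κN + (κN/(d+1)) Σ_i (|m_i| - 1)₊`. [folklore] -/
theorem key_ineq {κ : ℝ} (hκ : 0 ≤ κ) {N : ℕ} (hN : 1 ≤ N) (m : Fin (d + 1) → ℤ) (hm : m ≠ 0) :
    κ * N + κ * N / (d + 1) * ∑ i, (((m i).natAbs - 1 : ℕ) : ℝ) ≤ κ * supNorm (translate N 0 m) := by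
  set S := supNorm (translate N 0 m) with hS
  have hN' : (1 : ℝ) ≤ N := by exact_mod_cast hN
  -- each coordinate: N |m_i| ≤ S
  have hcoord : ∀ i, (N : ℝ) * |((m i : ℤ) : ℝ)| ≤ S := by
    intro i
    have h := abs_le_supNorm (translate N 0 m) i
    rw [translate_zero_apply] at h
    have e : ((|(N : ℤ) * m i| : ℤ) : ℝ) = (N : ℝ) * |((m i : ℤ) : ℝ)| := by
      rw [abs_mul]; push_cast; rw [abs_of_nonneg (by positivity : (0 : ℝ) ≤ N)]
    rw [e] at h; exact h
  -- some coordinate is nonzero, so S ≥ N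
  obtain ⟨i₀, hi₀⟩ : ∃ i, m i ≠ 0 := by
    by_contra h
    push Not at h
    exact hm (funext h)
  have hS1 : (N : ℝ) ≤ S := by
    have h1 : (1 : ℝ) ≤ |((m i₀ : ℤ) : ℝ)| := by
      have : (1 : ℤ) ≤ |m i₀| := Int.one_le_abs hi₀
      exact_mod_cast this
    have := hcoord i₀
    nlinarith
  -- each truncated coordinate: N * (|m_i| - 1)₊ ≤ S - N
  have hc : ∀ i, (N : ℝ) * (((m i).natAbs - 1 : ℕ) : ℝ) ≤ S - N := by
    intro i
    rcases eq_or_ne (m i) 0 with h | h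
    · rw [h]; simp; linarith
    · have h1 : 1 ≤ (m i).natAbs := Int.natAbs_pos.mpr h
      rw [Nat.cast_sub h1]
      have e : (((m i).natAbs : ℕ) : ℝ) = |((m i : ℤ) : ℝ)| := by
        rw [← Int.cast_natCast, Int.natCast_natAbs]; push_cast; rfl
      rw [e]; have := hcoord i; push_cast; nlinarith
  have hsum : (N : ℝ) * ∑ i, (((m i).natAbs - 1 : ℕ) : ℝ) ≤ (d + 1) * (S - N) := by
    rw [Finset.mul_sum]
    calc ∑ i, (N : ℝ) * (((m i).natAbs - 1 : ℕ) : ℝ) ≤ ∑ _i : Fin (d + 1), (S - N) :=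
          Finset.sum_le_sum fun i _ => hc i
      _ = (d + 1) * (S - N) := by
          rw [Finset.sum_const, Finset.card_univ, Fintype.card_fin, nsmul_eq_mul]; push_cast; ring
  have hd : (0 : ℝ) < d + 1 := by positivity
  have h2 : κ / (d + 1) * ((N : ℝ) * ∑ i, (((m i).natAbs - 1 : ℕ) : ℝ)) ≤ κ / (d + 1) * ((d + 1) * (S - N)) :=
    mul_le_mul_of_nonneg_left hsum (div_nonneg hκ hd.le)
  have e1 : κ * N / (d + 1) * ∑ i, (((m i).natAbs - 1 : ℕ) : ℝ)
      = κ / (d + 1) * ((N : ℝ) * ∑ i, (((m i).natAbs - 1 : ℕ) : ℝ)) := by ring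
  have e2 : κ / (d + 1) * ((d + 1) * (S - N)) = κ * (S - N) := by field_simp
  rw [e1]; rw [e2] at h2
  nlinarith

/-- the PRODUCT MAJORANT: for `m ≠ 0`, `e^{-κ|Nm|_∞} ≤ e^{-κN} Π_i ρ^{(|m_i|-1)₊}`, `ρ = e^{-κN/(d+1)}`. [folklore] -/
theorem exp_translate_le_prod {κ : ℝ} (hκ : 0 ≤ κ) {N : ℕ} (hN : 1 ≤ N) (m : Fin (d + 1) → ℤ) (hm : m ≠ 0) :
    Real.exp (-(κ * supNorm (translate N 0 m)))
      ≤ Real.exp (-(κ * N)) * ∏ i, weight (aliasRatio κ N d) (m i) := by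
  have h := key_ineq hκ hN m hm
  unfold weight aliasRatio
  simp_rw [← Real.exp_nat_mul]
  rw [← Real.exp_sum, ← Real.exp_add]
  apply Real.exp_le_exp.mpr
  have e : ∑ i, (((m i).natAbs - 1 : ℕ) : ℝ) * -(κ * N / (d + 1))
      = -(κ * N / (d + 1) * ∑ i, (((m i).natAbs - 1 : ℕ) : ℝ)) := by
    rw [Finset.mul_sum, ← Finset.sum_neg_distrib]
    apply Finset.sum_congr rfl; intro i _; ring
  rw [e]
  linarith

/-! ### §4. The aliasing tail bound -/

/-- THE ALIASING TAIL: `‖K(y)‖ ≤ M e^{-κ|y|_∞}`, `κ > 0`, `N ≥ 1` ⇒ the periodisation `Σ_m K(Nm)` converges and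
`‖Σ_{m ∈ ℤ^{d+1}} K(Nm) − K(0)‖ ≤ M · e^{-κN} ((3-ρ)/(1-ρ))^{d+1}`, `ρ = e^{-κN/(d+1)}`. [folklore] -/
theorem norm_tsum_translate_sub_le (K : (Fin (d + 1) → ℤ) → ℂ) {κ M : ℝ} (hκ : 0 < κ)
    (hK : ∀ y, ‖K y‖ ≤ M * Real.exp (-(κ * supNorm y))) {N : ℕ} (hN : 1 ≤ N) :
    Summable (fun m : Fin (d + 1) → ℤ => K (translate N 0 m)) ∧
      ‖(∑' m : Fin (d + 1) → ℤ, K (translate N 0 m)) - K 0‖ ≤ M * aliasConst κ N d := by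
  have hs : Summable (fun m : Fin (d + 1) → ℤ => K (translate N 0 m)) :=
    (periodise_bound K hκ hK hN 0 (fun i => by simp)).1
  refine ⟨hs, ?_⟩
  have hM : 0 ≤ M := by
    have h := hK 0
    have : supNorm (0 : Fin (d + 1) → ℤ) = 0 := by
      apply le_antisymm _ (supNorm_nonneg _)
      unfold supNorm; apply Finset.sup'_le; intro i _; simp
    rw [this] at h; simp at h; exact le_trans (norm_nonneg _) h
  set ρ := aliasRatio κ N d with hρ
  have hρ0 : 0 ≤ ρ := (aliasRatio_pos κ N d).le
  have hρ1 : ρ < 1 := aliasRatio_lt_one hκ hN d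
  -- the off-centre part as an `ite`
  set g : (Fin (d + 1) → ℤ) → ℂ := fun m => if m = 0 then 0 else K (translate N 0 m) with hg
  have hdecomp : (∑' m : Fin (d + 1) → ℤ, K (translate N 0 m)) = K 0 + ∑' m, g m := by
    have := hs.tsum_eq_add_tsum_ite 0
    simpa [hg] using this
  rw [hdecomp, add_sub_cancel_left]
  -- the majorant
  set F : (Fin (d + 1) → ℤ) → ℝ := fun m => M * Real.exp (-(κ * N)) * ∏ i, weight ρ (m i) with hF
  have hw := hasSum_weight hρ0 hρ1
  have hprod := summable_prod_pi (fun (_ : Fin (d + 1)) (j : ℤ) => weight ρ j) (fun _ j => weight_nonneg hρ0 j)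
    (fun _ => hw.1)
  have hFs : Summable F := by
    have := hprod.1.mul_left (M * Real.exp (-(κ * N)))
    exact this
  have hFsum : ∑' m, F m = M * aliasConst κ N d := by
    rw [hF]
    change ∑' m : Fin (d + 1) → ℤ, M * Real.exp (-(κ * N)) * ∏ i, weight ρ (m i) = _
    rw [tsum_mul_left, hprod.2]
    simp only [Finset.prod_const, Finset.card_univ, Fintype.card_fin]
    rw [hw.2]
    unfold aliasConst; rw [← hρ]; ring
  have hgF : ∀ m, ‖g m‖ ≤ F m := by
    intro m
    rcases eq_or_ne m 0 with rfl | hm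
    · simp only [hg, if_true, norm_zero, hF]
      apply mul_nonneg (mul_nonneg hM (Real.exp_pos _).le)
      exact Finset.prod_nonneg fun i _ => weight_nonneg hρ0 _
    · simp only [hg, hm, if_false, hF]
      calc ‖K (translate N 0 m)‖ ≤ M * Real.exp (-(κ * supNorm (translate N 0 m))) := hK _
        _ ≤ M * (Real.exp (-(κ * N)) * ∏ i, weight ρ (m i)) :=
            mul_le_mul_of_nonneg_left (exp_translate_le_prod hκ.le hN m hm) hM
        _ = M * Real.exp (-(κ * N)) * ∏ i, weight ρ (m i) := by ring
  have hgs : Summable (fun m => ‖g m‖) := Summable.of_nonneg_of_le (fun m => norm_nonneg _) hgF hFs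
  calc ‖∑' m, g m‖ ≤ ∑' m, ‖g m‖ := norm_tsum_le_tsum_norm hgs
    _ ≤ ∑' m, F m := hgs.tsum_le_tsum hgF hFs
    _ = M * aliasConst κ N d := hFsum

/-! ### §5. The torus reading: grid sum of a strip-regular multiplier versus its Brillouin-zone mean -/

/-- the torus kernel at the origin is the NORMALISED GRID SUM `N^{-(d+1)} Σ_{k ∈ (ℤ/N)^{d+1}} f(k/N)`. [folklore] -/
theorem torusKernel_zero (f : C(UnitAddTorus (Fin (d + 1)), ℂ)) (N : ℕ) :
    torusKernel f N 0 = ((N : ℂ) ^ (d + 1))⁻¹ * ∑ k : Fin (d + 1) → Fin N, f (gridPt N k) := by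
  unfold torusKernel torusSum
  congr 1
  apply Finset.sum_congr rfl
  intro k _
  simp [UnitAddTorus.mFourier_zero]

/-- GRID SUM VERSUS BRILLOUIN-ZONE MEAN for a strip-regular multiplier: `StripRegular G κ M`, `κ > 0`, `N ≥ 1` ⇒
`‖N^{-(d+1)} Σ_{k ∈ (ℤ/N)^{d+1}} G(2π rep(k/N)) − latticeKernel G 0‖ ≤ M · aliasConst κ N d`, where
`latticeKernel G 0 = (2π)^{-(d+1)} ∫_{[-π,π]^{d+1}} G`. [cite: Balaban1984PropagatorsI, p. 36 l. 20–23 with p. 38 (1.126), dictionary] [folklore] -/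
theorem norm_torusKernel_zero_sub_latticeKernel_zero_le {G : (Fin (d + 1) → ℂ) → ℂ} {κ M : ℝ}
    (h : StripRegular G κ M) (hκ : 0 < κ) {N : ℕ} (hN : 1 ≤ N) :
    ‖torusKernel (descendC G h hκ.le) N 0 - latticeKernel G 0‖ ≤ M * aliasConst κ N d := by
  rw [torusKernel_descend_eq h hκ hN 0]
  exact (norm_tsum_translate_sub_le (latticeKernel G) hκ (latticeKernel_decay h hκ.le) hN).2

/-- the same with the grid sum displayed. [cite: Balaban1984PropagatorsI, p. 36 l. 20–23 with p. 38 (1.126), dictionary] [folklore] -/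
theorem norm_gridMean_sub_latticeKernel_zero_le {G : (Fin (d + 1) → ℂ) → ℂ} {κ M : ℝ}
    (h : StripRegular G κ M) (hκ : 0 < κ) {N : ℕ} (hN : 1 ≤ N) :
    ‖((N : ℂ) ^ (d + 1))⁻¹ * (∑ k : Fin (d + 1) → Fin N, descend G (gridPt N k)) - latticeKernel G 0‖
      ≤ M * aliasConst κ N d := by
  have := norm_torusKernel_zero_sub_latticeKernel_zero_le h hκ hN
  rw [torusKernel_zero] at this
  simpa using this

/-! ### §6. The certified-enclosure reading (real parts; how the CAP lane's registry rows are consumed) -/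

/-- FROM A CERTIFIED GRID VALUE TO A CERTIFIED LOWER BOUND OF THE ZONE MEAN: if the grid mean `T` is known to within `r`
of a real number `t` (`‖T − t‖ ≤ r`, the engines' ball) and `‖T − c‖ ≤ A` (the aliasing tail), then `t − r − A ≤ Re c`.
Pure triangle inequality; the kernel's part of the CAP lane's `lo := t − r − M·aliasConst κ N d`. [folklore] -/
theorem re_ge_of_enclosures {T c : ℂ} {t r A : ℝ} (hT : ‖T - t‖ ≤ r) (hA : ‖T - c‖ ≤ A) :
    t - r - A ≤ c.re := by
  have h1 : |(T - t).re| ≤ r := le_trans (Complex.abs_re_le_norm _) hT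
  have h2 : |(T - c).re| ≤ A := le_trans (Complex.abs_re_le_norm _) hA
  simp only [Complex.sub_re, Complex.ofReal_re] at h1 h2
  rw [abs_le] at h1 h2
  linarith [h1.1, h1.2, h2.1, h2.2]

/-- the assembled statement: `StripRegular G κ M`, `κ > 0`, `N ≥ 1`, a ball `‖T_N − t‖ ≤ r` for the grid mean
`T_N = N^{-(d+1)} Σ_k G(2π rep(k/N))` ⇒ `t − r − M·aliasConst κ N d ≤ Re (latticeKernel G 0)`. [folklore] -/
theorem latticeKernel_zero_re_ge {G : (Fin (d + 1) → ℂ) → ℂ} {κ M : ℝ}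
    (h : StripRegular G κ M) (hκ : 0 < κ) {N : ℕ} (hN : 1 ≤ N) {t r : ℝ}
    (hT : ‖torusKernel (descendC G h hκ.le) N 0 - t‖ ≤ r) :
    t - r - M * aliasConst κ N d ≤ (latticeKernel G 0).re :=
  re_ge_of_enclosures hT (norm_torusKernel_zero_sub_latticeKernel_zero_le h hκ hN)

end

end Literature.MathematicalPhysics.QuantumFieldTheory.Balaban1983to89.Beta.AliasingTail
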